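import Summits.BirchSwinnertonDyer.BirchSwinnertonDyer.Theorems.AdditiveKolyvaginRoadManinFrameTransport
import HarnessLib

/-!
# Route `AdditiveKolyvaginRoad`, the PROPER Manin residue: its universal modular-degree clause is
# `p ∣ deg φ₀` at the `X₀(N)`-optimal curve of the class — route-independent certificate

Cell `pub/bsd-wall` (D-0120, W-ALL lane 3, row 2), seat `bsd-wall-akr-p2` (prover, g4). THEOREMS
ONLY (no definition, no named fact, no `sorry`); nothing is booked. NO route file is imported
(theses-cone hygiene, as in `AdditiveKolyvaginRoadManinFrameTransport.lean`).

WHAT THIS IS FOR. The second resplit of the crux `ManinGoodOddFrameAdditive`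
(stmt-BirchSwinnertonDyer-20136) isolates the PROPER Manin residue: the frames `(W, p)` of the
residue locus such that EVERY parametrisation datum `D'` at level `N(W)` of EVERY globally minimal
`W' ∼ W` has `p ∣ deg D'` (the complement, "some datum of some member has `p ∤ deg`", is closed by
Česnavičius–Neururer–Saha 2024 Thm. 1.2, `ManinFrameTransport` §3). This file makes that universal
clause CONCRETE: it is equivalent to `p ∣ deg φ₀` for the lattice-optimal datum `φ₀` of the
`X₀(N)`-optimal (strong Weil) curve `W₀` of the class — the census key "`p` divides the modular
degree of the optimal curve". Together with `ManinFrameTransport` §4 (the frame's sixth conjunct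
`∃ Dt, p ∤ c(Dt)` is equivalent to `p ∤ c₀` at the optimal curve) the proper residue therefore reads,
class by class: *for the optimal curves `E₀` of the residue types with `p ∣ deg φ₀`, `p ∤ c₀`* —
the `p`-part of Manin's conjecture exactly there.

* `modularDegree_dvd_of_latticeOptimal` — for a LATTICE-OPTIMAL datum `D₀` of `W₀`
  (`Λ_{W₀} = c₀ Λ_f`) and any datum `D'` of any `W'` at the same level with the same newform,
  `deg D₀ ∣ deg D'`; indeed `deg D' = [Λ_{W'} : c' Λ_f] · deg D₀` (tree degree formula
  `modularDegree_eq_card_ker_mul`; Knapp 1993 Prop. 12.9: the strong Weil parametrisation has the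
  least degree and every parametrisation factors through it).
* `f_eq_of_isIsogenous` — data of `ℚ`-isogenous elliptic curves at the same level carry the same
  newform (`IsNewformOf.of_isIsogenous` and the `q`-expansion principle).
* `modularDegree_dvd_of_isIsogenous` — hence `deg D₀ ∣ deg D'` for every datum `D'` of every
  elliptic `W' ∼ W₀`.
* `forall_dvd_modularDegree_iff_dvd_optimal` — **the certificate**: for `W ∼ W₀` with `W₀`
  globally minimal carrying a lattice-optimal datum `D₀` at level `N`, the clause
  "`∀` globally minimal `W' ∼ W`, `∀ D'` at level `N`, `p ∣ deg D'`" is EQUIVALENT to `p ∣ deg D₀`.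
* `exists_optimal_dvd_iff` — the same packaged with Modularity (`X12.exists_isIsogenous_optimal`):
  every globally minimal `W` has a globally minimal `W₀ ∼ W` with a lattice-optimal datum `D₀` at
  level `N(W)` for which the universal clause is `p ∣ deg D₀`; so the resplit's dichotomy, read at
  the optimal curve, is `p ∣ deg D₀` (proper residue) or `p ∤ deg D₀` (degree class).

References: [Knapp1993] Prop. 12.9 and p. 302; [EdixhovenManin1991] §1, Prop. 2;
[CesnaviciusNeururerSaha2023] Thm. 1.2 and §1 (why the degree is the right key);
[PastenShimura2024] §2 p. 12 (optimal quotient).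
-/

set_option autoImplicit false
-- the Theorems directory repeats the summit name (sibling precedent `SignedBaseChangeAssembly.lean`)
set_option linter.dupNamespace false

noncomputable section

open scoped Classical

open WeierstrassCurve Literature.NumberTheory.EllipticCurves
  Literature.NumberTheory.EllipticCurves.ModularForms

namespace Summit.BirchSwinnertonDyer.BirchSwinnertonDyer.Theorems.ManinResidueDegreeOptimal

/-- **A lattice-optimal datum divides every datum with its newform, in degree.** If `D₀` is a
parametrisation datum of `W₀/ℚ` at level `N` with `Λ_{W₀} = c₀ Λ_f` (lattice-optimal: the strong
Weil parametrisation) and `D'` is any datum of any `W'/ℚ` at level `N` with the same newform, then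
`deg D₀ ∣ deg D'` — indeed `deg D' = [Λ_{W'} : c' Λ_f] · deg D₀` by the tree's degree formula
`modularDegree_eq_card_ker_mul` (fibre counts multiply along `Y₀(N) → ℂ/Λ_f → ℂ/Λ_{W'}`).
[cite: Knapp1993, Prop. 12.9(a) and p. 302] -/
theorem modularDegree_dvd_of_latticeOptimal {N : ℕ} [NeZero N] {W₀ W' : WeierstrassCurve ℚ}
    (D₀ : ModularParametrizationData W₀ N)
    (hopt : ∀ z ∈ D₀.L.lattice, ∃ w ∈ periodLattice D₀.f, z = D₀.c * w)
    (D' : ModularParametrizationData W' N) (hf : D'.f = D₀.f) :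
    D₀.modularDegree ∣ D'.modularDegree := by
  have hinj : Function.Injective D₀.isogenyMap :=
    (AddMonoidHom.ker_eq_bot_iff _).mp (D₀.isogenyMap_ker_eq_bot_iff.mpr hopt)
  obtain ⟨-, hdeg⟩ := D'.modularDegree_eq_card_ker_mul hf D₀.smul_periodLattice_le hinj
    D₀.deg_pos D₀.finite_setOf_natCard_fiberOrbits_ne
  exact ⟨Nat.card D'.isogenyMap.ker, by rw [hdeg, mul_comm]; rfl⟩

/-- **Data of `ℚ`-isogenous elliptic curves at one level carry the same newform**: for `W' ∼ W₀`
elliptic over `ℚ` and data `D'` of `W'`, `D₀` of `W₀` at level `N`, `D'.f = D₀.f` — both are THE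
newform of the class (`IsNewformOf.of_isIsogenous`: isogenous curves have the same `L`-series) and a
cusp form on `Γ₀(N)` is determined by its `q`-expansion (`eq_of_forall_cuspCoeff_eq_gamma0`).
[cite: Knapp1993, Thm. 11.67 (PDF p. 281)] -/
theorem f_eq_of_isIsogenous {N : ℕ} [NeZero N] {W₀ W' : WeierstrassCurve ℚ} [W₀.IsElliptic]
    [W'.IsElliptic] (hiso : IsIsogenous W' W₀) (D₀ : ModularParametrizationData W₀ N)
    (D' : ModularParametrizationData W' N) : D'.f = D₀.f := by
  have hfW' : IsNewformOf W' D₀.f := D₀.isNewformOf.of_isIsogenous hiso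
  exact eq_of_forall_cuspCoeff_eq_gamma0 fun n ↦ by rw [D'.isNewformOf.2 n, hfW'.2 n]

/-- **The optimal degree divides every degree in the isogeny class**: for a lattice-optimal datum
`D₀` of `W₀/ℚ` at level `N` and any datum `D'` at level `N` of any elliptic `W' ∼ W₀` over `ℚ`,
`deg D₀ ∣ deg D'`. [cite: Knapp1993, Prop. 12.9(a) and p. 302] -/
theorem modularDegree_dvd_of_isIsogenous {N : ℕ} [NeZero N] {W₀ W' : WeierstrassCurve ℚ}
    [W₀.IsElliptic] [W'.IsElliptic] (hiso : IsIsogenous W' W₀)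
    (D₀ : ModularParametrizationData W₀ N)
    (hopt : ∀ z ∈ D₀.L.lattice, ∃ w ∈ periodLattice D₀.f, z = D₀.c * w)
    (D' : ModularParametrizationData W' N) : D₀.modularDegree ∣ D'.modularDegree :=
  modularDegree_dvd_of_latticeOptimal D₀ hopt D' (f_eq_of_isIsogenous hiso D₀ D')

/-- **The certificate: the proper residue's universal degree clause is `p ∣ deg φ₀` at the optimal
curve.** Let `W/ℚ` be elliptic, `W₀ ∼ W` globally minimal elliptic carrying a LATTICE-OPTIMAL datum
`D₀` at level `N` (the strong Weil curve of the class with its `X₀(N)`-optimal parametrisation;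
exists by Modularity, `X12.exists_isIsogenous_optimal`), and `p` any natural number. Then
"every datum `D'` at level `N` of every globally minimal elliptic `W' ∼ W` has `p ∣ deg D'`" holds
IFF `p ∣ deg D₀`: (→) instantiate at `(W₀, D₀)`; (←) `deg D₀ ∣ deg D'`
(`modularDegree_dvd_of_isIsogenous`, isogeny being an equivalence relation over `ℚ`).
[cite: Knapp1993, Prop. 12.9(a) and p. 302] [cite: EdixhovenManin1991, Prop. 2] -/
theorem forall_dvd_modularDegree_iff_dvd_optimal {N : ℕ} [NeZero N] (p : ℕ)
    (W : WeierstrassCurve ℚ) [W.IsElliptic]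
    {W₀ : WeierstrassCurve ℚ} [W₀.IsElliptic] [W₀.IsGloballyMinimal] (hiso : IsIsogenous W W₀)
    (D₀ : ModularParametrizationData W₀ N)
    (hopt : ∀ z ∈ D₀.L.lattice, ∃ w ∈ periodLattice D₀.f, z = D₀.c * w) :
    (∀ (W' : WeierstrassCurve ℚ) [W'.IsElliptic] [W'.IsGloballyMinimal]
        (D' : ModularParametrizationData W' N), IsIsogenous W W' → p ∣ D'.modularDegree) ↔
      p ∣ D₀.modularDegree := by
  constructor
  · intro h
    exact h W₀ D₀ hiso
  · intro h W' _ _ D' hiso'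
    -- `W' ∼ W₀`: symmetry and transitivity of `ℚ`-isogeny
    have h' : IsIsogenous W' W₀ := (hiso'.symm_of_charZero).trans' hiso
    exact h.trans (modularDegree_dvd_of_isIsogenous h' D₀ hopt D')

/-- **The resplit dichotomy read at the optimal curve** (Modularity by name, `hnf`): for `W/ℚ`
globally minimal elliptic and any `p`, there is a globally minimal elliptic `W₀ ∼ W` of the same
conductor with a lattice-optimal datum `D₀` at level `N(W)`, and EITHER `p ∣ deg D₀` — equivalently
(`forall_dvd_modularDegree_iff_dvd_optimal`) every level-`N(W)` datum of every globally minimal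
member has degree divisible by `p`: the PROPER residue — OR `p ∤ deg D₀`, a datum of a globally
minimal member of degree prime to `p`: the DEGREE class (closed by Česnavičius–Neururer–Saha,
`ManinFrameTransport.exists_oddHeegnerFrame_of_not_dvd_modularDegree`).
[cite: PastenShimura2024, §2 (p. 12)] [cite: Knapp1993, Prop. 12.9(a)]
[cite: CesnaviciusNeururerSaha2023, Thm. 1.2] -/
theorem exists_optimal_dvd_iff (hnf : exists_isNewformOf) (p : ℕ)
    (W : WeierstrassCurve ℚ) [W.IsElliptic] [W.IsGloballyMinimal] [NeZero (W.conductorNorm ℤ)] :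
    ∃ (W₀ : WeierstrassCurve ℚ) (_ : W₀.IsElliptic) (_ : W₀.IsGloballyMinimal)
      (D₀ : ModularParametrizationData W₀ (W.conductorNorm ℤ)),
      IsIsogenous W W₀ ∧ (∀ z ∈ D₀.L.lattice, ∃ w ∈ periodLattice D₀.f, z = D₀.c * w) ∧
        ((∀ (W' : WeierstrassCurve ℚ) [W'.IsElliptic] [W'.IsGloballyMinimal]
            (D' : ModularParametrizationData W' (W.conductorNorm ℤ)),
            IsIsogenous W W' → p ∣ D'.modularDegree) ↔ p ∣ D₀.modularDegree) := by
  obtain ⟨W₀, hE₀, hM₀, hNz₀, D₀, hiso, hN, hopt₀⟩ :=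
    Summit.BirchSwinnertonDyer.Rank1Residual.X12.exists_isIsogenous_optimal hnf W
  haveI := hE₀
  haveI := hM₀
  -- move the optimal datum to the level `N(W) = N(W₀)` (bookkeeping)
  obtain ⟨D₀', hopt'⟩ :=
    Summit.BirchSwinnertonDyer.Rank1Residual.X12.exists_optimalDatum_of_level_eq hN D₀ hopt₀
  exact ⟨W₀, hE₀, hM₀, D₀', hiso, hopt',
    forall_dvd_modularDegree_iff_dvd_optimal p W hiso D₀' hopt'⟩

end Summit.BirchSwinnertonDyer.BirchSwinnertonDyer.Theorems.ManinResidueDegreeOptimal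

end
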